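import Summits.QuantumFields.BalabanUV.T4Continuum.Support.NE7TangentTransportTop
import HarnessLib

/-!
# NE7TangentTransportCurved — THE GAUGE-CORRECTED TEST-FIELD TRANSPORT (TT) OF (APE) AT A CURVED REFERENCE BACKGROUND: F52∕(153)'s identity with the
# flat reference `1` replaced by any `W` of the class at which `Y` is tangent, the exact TOP-MISMATCH defect it leaves, and its price
# `c_R·(Λ + 2·d·ω·C_F)` — letter (L4) of the curved (APE) programme, file 4 (assembly)

Cell `pub-balaban`, rung (B)+1 sub-cell t4, lineage `b2b-balaban-t4-ne7-p1` (CRUX PROVER NE7 #1 = OWNER of row NE7), generation 76; memo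
`t4/b2b-balaban-t4-ne7-p1-g75/CURVED-APE-ROAD.md` §2 (L4).  File F70 (over F52 `NE7TangentTransportGauge` (the bookkeeping `dAction_sub'`, `dirIter_skew_periodic`,
`cornerLift_smul`, `cornerLift_add_period`), p2's (153) `NE7TangentTransportTop` (`norm_Ad_inv_sub_le`), leaf-04's `NE3TangentCovariantTower` (the structure theorem
`dirIter_eq_QbarIter_add_gaugeDir`, `dirIter_gaugeDir`, `dirIter_add`), `NE3CurvedFrameKill.framePotW_skew_periodic`, `NE3LandauOrbit.gaugeDir_skew`,
`NE3ResidualSliceRep.dirIter_sub` and **`NE3PureGaugeFirstVariation.dAction_gaugeDir`** (the first variation vanishes on pure gauge directions, EXACTLY)).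
WHY (memo §2 (L4)).  F55∕F59∕F66 carry the letter `hTT`: every skew periodic `Y` TANGENT AT THE BACKGROUND `W` (`D_W Y = 0`) has a `Y′` tangent at the representative
`U` with `|dAction U (Y′ − Y)| ≤ τ‖Y‖₁`.  F52∕(153) prove it at the FLAT reference (`D_1 Y = 0`).  THIS FILE is the curved twin: by the SAME tree identities at `U` and at
`W`,  `D_U(Y + gaugeDir_U λ)(z,κ) = Q̄^{(k+1)}_U Y (z,κ) − Q̄^{(k+1)}_W Y (z,κ) + (Ad_{U_top(z,κ)⁻¹} − Ad_{W_top(z,κ)⁻¹})(F_W Y (z))`   (§2)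
EXACTLY, for the corner lift `λ` of `F_W Y − F_U Y` (`F_V Y = framePotW L (k+1) V Y` the accumulated frame potential, `V_top = cavgIter L (k+1) V`): the frames of
BOTH backgrounds are absorbed by ONE fine gauge direction, the straight towers are compared (F67∕F68∕F69: `Λ = K_maj·(L∕L^d)^j·Σ_i λ(r_i, x_i)`), and what is left
is the TOP MISMATCH acting on the reference frame potential — it vanishes iff the two top averages act identically on `F_W Y`, in particular when `U_top = W_top`
(representative and background on the SAME fibre).  Consequently (§3) the repaired (TT) holds at the price `c_R·(Λ + 2·d·ω·C_F)`, `ω` the top mismatch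
`‖U_top(z,κ) − W_top(z,κ)‖ ≤ ω`, `C_F` the `ℓ¹` letter of `F_W Y`.  THE LOCATED CURRENCY POINT (memo successor note): `c_R = a·C·M^{d−2}`, `Λ = λ̂·M^{1−d}` with
`λ̂ = O(b + α̂)`, `C_F = O(1)` — so the defect is of the order of `c_R·Λ` iff `ω ≲ λ̂·M^{1−d}`; a B8-type Landau representative `U^u = W e^{Z}` moves the top by the
corner values of `u` (`cavgIter_gaugeAct`), `ω = O(‖u − 1‖_∞)`, which the (APE) assembly must therefore control at the order `M^{1−d}` (fibre-preserving representative,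
or `ω = 0` when `U` and `W` lie over the same datum and `u` is pinned at the corners).  This file displays `ω` and asserts no smallness of it.
WHAT ([folklore]; 0 def, 0 sorry).
§1 `norm_Ad_inv_sub_Ad_inv_le` — `‖Ad_{a⁻¹} X − Ad_{b⁻¹} X‖ ≤ 2‖a − b‖·‖X‖` for unitary `a`, `b`; `gaugeDir_add_gen` (additivity of `gaugeDir` in the generator).
§2 **`dirIter_add_gaugeDir_eq_Qbar_sub_Qbar_add_defect`** — the identity displayed above, at any `W` of the class with `D_W Y = 0`.
§3 **`tangent_transport_curved`** — THE REPAIRED (TT) AT A CURVED REFERENCE: `U`, `W` unitary `T`-periodic in the multi-level class (`T = tower L N (k+1)`), an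
   abstract right inverse `R` of `D_U` (exact on skew `N`-periodic coarse data, skew `T`-periodic values, first-variation bound `c_R`), the letters `Λ` (straight
   towers, F68), `ω` (top mismatch), `C_F` (frame potential at `W` in `ℓ¹`); THEN every skew `T`-periodic `Y` with `D_W Y = 0` has a skew `T`-periodic `Y′` with
   `D_U Y′ = 0` and `|dAction U (Y′ − Y) (perWin d T)| ≤ c_R·(Λ + 2·d·ω·C_F)·‖Y‖_{ℓ¹(periodBox T)}`.
HONEST FRAMING (page 1): lattice kinematics + the exact gauge invariance of the first variation, over tree identities; `R`, `Λ`, `ω`, `C_F` are HYPOTHESES; at `W = 1`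
§3 is (153) `tangent_transport_top` (not restated); (APE) on curved data NOT proved; NOT ONE-STEP, NOT NE7; spine 0∕9; finite T⁴ rung (B)+1 — NOT infinite volume,
NOT mass gap, NOT `BetaPertH`, NOT Clay.  Continuum YM on T⁴ ⇐ BetaPertH ∧ nine spine estimates (0/9 proved); BetaPertH ⇐ (D1) ∧ (D4) ∧ CAP+tail; G-an2-4 gates
asym, D1 and NE2/3/4.
-/

set_option autoImplicit false

open scoped BigOperators Matrix.Norms.L2Operator
open NormedSpace Finset

namespace Summit.QuantumFields.BalabanUV.T4Continuum.NE7TangentTransportCurved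

open Literature.MathematicalPhysics.QuantumFieldTheory.Balaban1983to89
open B7Prop1Explicit B7Prop2Explicit MatrixLog UnitaryModel
open T4AveragingDeficitWall (IsUnitaryCfg IsSkewDir SmallField Ad dirL1)
open T4AveragingDeficitWallBoundary (IsPeriodicCfg periodBox)
open AveragingDeficitPeriodicCounting (IsPeriodicDir)
open AveragingDeficitMultiLevelPrep (cavgIter LevelSmall tower cavgIter_unitary_small)
open AveragingDeficitNearIdentity (norm_Ad_sub_le)
open AveragingDeficitTransport (mem_U1_of_unitary norm_Ad_of_unitary)
open T4AveragingDeficitNonAbelian (Ad_sub Ad_mul)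
open MinimalActionLevels (perWin)
open BlockAveragePushDirGauge (gaugeDir isPeriodicDir_gaugeDir)
open NE3TangentCovariantTower (dirIter QbarIter framePotW dirIter_add dirIter_gaugeDir dirIter_eq_QbarIter_add_gaugeDir)
open NE3CurvedFrameKill (framePotW_skew_periodic pow_succ_mul_eq_tower)
open NE3LandauOrbit (gaugeDir_skew)
open NE3ResidualSliceRep (dirIter_sub)
open NE3HessForm (dAction)
open NE3PureGaugeFirstVariation (dAction_gaugeDir)
open NE7TangentTransportGauge (dAction_sub' dirIter_skew_periodic cornerLift_smul cornerLift_add_period)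
open NE7TangentTransportTop (norm_Ad_inv_sub_le)

noncomputable section

variable {d : ℕ} {n : Type*} [Fintype n] [DecidableEq n]

/-! ## §1 Two bookkeeping lemmas -/

/-- For unitary bond variables `a`, `b`: `‖Ad_{a⁻¹} X − Ad_{b⁻¹} X‖ ≤ 2·‖a − b‖·‖X‖` (`Ad_{a⁻¹}X − Ad_{b⁻¹}X = Ad_{b⁻¹}(Ad_{(b⁻¹a)⁻¹} X − X)`-type split). [folklore] -/
theorem norm_Ad_inv_sub_Ad_inv_le [Nonempty n] {a b : (Matrix n n ℂ)ˣ} (ha : a ∈ unitaryUnits (Matrix n n ℂ)) (hb : b ∈ unitaryUnits (Matrix n n ℂ)) (X : (Matrix n n ℂ)) :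
    ‖Ad a⁻¹ X - Ad b⁻¹ X‖ ≤ 2 * ‖(a : (Matrix n n ℂ)) - (b : (Matrix n n ℂ))‖ * ‖X‖ := by
  -- `Ad_{a⁻¹} X − Ad_{b⁻¹} X = Ad_{(b⁻¹ a)⁻¹} Z − Z`, `Z = Ad_{b⁻¹} X`
  have hba : b⁻¹ * a ∈ unitaryUnits (Matrix n n ℂ) := (unitaryUnits (Matrix n n ℂ)).mul_mem ((unitaryUnits (Matrix n n ℂ)).inv_mem hb) ha
  have e : Ad a⁻¹ X - Ad b⁻¹ X = Ad (b⁻¹ * a)⁻¹ (Ad b⁻¹ X) - Ad b⁻¹ X := by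
    rw [← Ad_mul, mul_inv_rev, inv_inv, mul_inv_cancel_right]
  have hZ : ‖Ad b⁻¹ X‖ = ‖X‖ := norm_Ad_of_unitary ((unitaryUnits (Matrix n n ℂ)).inv_mem hb) X
  rw [e]
  refine (norm_Ad_inv_sub_le hba (Ad b⁻¹ X)).trans ?_
  rw [hZ]
  have h1 : ‖((b⁻¹ * a : (Matrix n n ℂ)ˣ) : (Matrix n n ℂ)) - 1‖ ≤ ‖(a : (Matrix n n ℂ)) - (b : (Matrix n n ℂ))‖ := by
    have e2 : ((b⁻¹ * a : (Matrix n n ℂ)ˣ) : (Matrix n n ℂ)) - 1 = ((b⁻¹ : (Matrix n n ℂ)ˣ) : (Matrix n n ℂ)) * ((a : (Matrix n n ℂ)) - (b : (Matrix n n ℂ))) := by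
      rw [Units.val_mul, mul_sub, Units.inv_mul]
    rw [e2]
    calc _ ≤ ‖((b⁻¹ : (Matrix n n ℂ)ˣ) : (Matrix n n ℂ))‖ * ‖(a : (Matrix n n ℂ)) - (b : (Matrix n n ℂ))‖ := norm_mul_le _ _
      _ ≤ 1 * ‖(a : (Matrix n n ℂ)) - (b : (Matrix n n ℂ))‖ :=
          mul_le_mul_of_nonneg_right (mem_U1.mp (mem_U1_of_unitary hb)).2 (norm_nonneg _)
      _ = _ := one_mul _
  have h0 : 0 ≤ ‖X‖ := norm_nonneg _
  nlinarith

/-- `gaugeDir V (λ₁ + λ₂) = gaugeDir V λ₁ + gaugeDir V λ₂` pointwise (the gauge direction is additive in the generator). [folklore] -/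
theorem gaugeDir_add_gen (V : Site d → Fin d → (Matrix n n ℂ)ˣ) (lam₁ lam₂ : Site d → (Matrix n n ℂ)) (z : Site d) (κ : Fin d) :
    gaugeDir V (fun w => lam₁ w + lam₂ w) z κ = gaugeDir V lam₁ z κ + gaugeDir V lam₂ z κ := by
  simp only [gaugeDir, Ad, mul_add, add_mul]
  abel

/-! ## §2 F52's identity at a CURVED reference: the exact top-mismatch defect -/

/-- **`D_U(Y + gaugeDir_U λ) = Q̄^{(k+1)}_U Y − Q̄^{(k+1)}_W Y + (Ad_{U_top⁻¹} − Ad_{W_top⁻¹}) F_W Y`** for the corner lift `λ` of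
`framePotW L (k+1) W Y − framePotW L (k+1) U Y`, when `Y` is tangent at the CURVED reference `W` of the class (`dirIter L (k+1) W Y = 0`): the structure theorem at
`U` and at `W`, the covariance of the average along fine gauge directions at `U`, additivity.  At `W = 1` this is (153) §2. [folklore] -/
theorem dirIter_add_gaugeDir_eq_Qbar_sub_Qbar_add_defect [Nonempty n] {L N : ℕ} [NeZero N] (hL : 1 ≤ L) (k : ℕ)
    {U W : Site d → Fin d → (Matrix n n ℂ)ˣ} {x : ℝ} (hUu : IsUnitaryCfg U) (hWu : IsUnitaryCfg W)
    (hUP : IsPeriodicCfg U ((tower L N (k + 1) : ℕ) : ℤ)) (hWP : IsPeriodicCfg W ((tower L N (k + 1) : ℕ) : ℤ))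
    (hx : 0 ≤ x) (hs : LevelSmall d L k x) (hUx : SmallField U x) (hWx : SmallField W x)
    {Y : Site d → Fin d → (Matrix n n ℂ)} (hY : IsSkewDir Y) (hYP : IsPeriodicDir Y ((tower L N (k + 1) : ℕ) : ℤ))
    (hYT : dirIter L (k + 1) W Y = 0) (z : Site d) (κ : Fin d) :
    dirIter L (k + 1) U (fun y μ => Y y μ
        + gaugeDir U (fun xx : Site d => (fun w => framePotW L (k + 1) W Y w - framePotW L (k + 1) U Y w) (fun i => xx i / ((L : ℤ) ^ (k + 1)))) y μ) z κ
      = QbarIter L (k + 1) U Y z κ - QbarIter L (k + 1) W Y z κ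
        + (Ad (cavgIter L (k + 1) U z κ)⁻¹ (framePotW L (k + 1) W Y z) - Ad (cavgIter L (k + 1) W z κ)⁻¹ (framePotW L (k + 1) W Y z)) := by
  have hm : ((L : ℤ) ^ (k + 1)) ≠ 0 := pow_ne_zero _ (by exact_mod_cast (show L ≠ 0 by omega))
  have htow : ((tower L N (k + 1) : ℕ) : ℤ) = (L : ℤ) ^ (k + 1) * (N : ℤ) := (pow_succ_mul_eq_tower L N k).symm
  -- the two accumulated frame potentials: skew and `N`-periodic
  set g : Site d → (Matrix n n ℂ) := fun w => framePotW L (k + 1) W Y w - framePotW L (k + 1) U Y w with hg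
  obtain ⟨hFUs, hFUP⟩ := framePotW_skew_periodic (M := N) hL k hUu hUP hx hs hUx hY hYP
  obtain ⟨hFWs, hFWP⟩ := framePotW_skew_periodic (M := N) hL k hWu hWP hx hs hWx hY hYP
  have hgs : ∀ w, g w ∈ skewAdjoint (Matrix n n ℂ) := fun w => (skewAdjoint (Matrix n n ℂ)).sub_mem (hFWs w) (hFUs w)
  have hgP : ∀ (w : Site d) (i : Fin d), g (w + (N : ℤ) • e i) = g w := fun w i => by simp only [hg, hFWP w i, hFUP w i]
  -- the corner lift
  set lam : Site d → (Matrix n n ℂ) := fun xx => g (fun i => xx i / ((L : ℤ) ^ (k + 1))) with hlam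
  have hlams : ∀ xx, lam xx ∈ skewAdjoint (Matrix n n ℂ) := fun xx => hgs _
  have hlamP : ∀ (y : Site d) (i : Fin d), lam (y + ((tower L N (k + 1) : ℕ) : ℤ) • e i) = lam y := fun y i => by
    rw [htow]; exact cornerLift_add_period g hm hgP y i
  have hlam_corner : (fun y : Site d => lam (((L : ℤ) ^ (k + 1)) • y)) = g := by
    funext y; exact cornerLift_smul g hm y
  -- the tree identities: additivity and gauge covariance at `U`, the structure theorem at `U` and at `W`
  have hadd := dirIter_add hL k hUu hx hs hUx Y (gaugeDir U lam)
  have hgauge := dirIter_gaugeDir (M := N) hL k hUu hUP hx hs hUx hlams hlamP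
  have hstrU := dirIter_eq_QbarIter_add_gaugeDir (M := N) hL k hUu hUP hx hs hUx hY hYP
  have hstrW := dirIter_eq_QbarIter_add_gaugeDir (M := N) hL k hWu hWP hx hs hWx hY hYP
  -- tangency at `W`: `Q̄_W Y (z,κ) + gaugeDir W_top (F_W Y) (z,κ) = 0`
  have hW0 : QbarIter L (k + 1) W Y z κ + gaugeDir (cavgIter L (k + 1) W) (framePotW L (k + 1) W Y) z κ = 0 := by
    have h := congr_fun (congr_fun hstrW z) κ
    rw [hYT] at h
    exact h.symm
  -- assemble pointwise
  have h1 := congr_fun (congr_fun hadd z) κ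
  have h2 := congr_fun (congr_fun hgauge z) κ
  have h3 := congr_fun (congr_fun hstrU z) κ
  rw [h1, h2, h3, hlam_corner]
  have hQW : QbarIter L (k + 1) W Y z κ = -gaugeDir (cavgIter L (k + 1) W) (framePotW L (k + 1) W Y) z κ := eq_neg_of_add_eq_zero_left hW0
  rw [hQW]
  simp only [gaugeDir, hg, Ad_sub]
  abel

/-! ## §3 THE REPAIRED TEST-FIELD TRANSPORT AT A CURVED REFERENCE -/

/-- **THE GAUGE-CORRECTED TEST-FIELD TRANSPORT (TT) OF (APE) AT A CURVED REFERENCE BACKGROUND** (statement in the module docstring, §3):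
`Y′ = Y + gaugeDir_U λ − R(D_U(Y + gaugeDir_U λ))` with §2's `λ`; the gauge part costs nothing (`dAction_gaugeDir`), the straight towers cost `Λ`, the top mismatch
`2·d·ω·C_F` (`norm_Ad_inv_sub_Ad_inv_le`).  At `W = 1` (then `D_1 Y = 0`, `W_top = 1`) this is (153) `tangent_transport_top`. [folklore] -/
theorem tangent_transport_curved [Nonempty n] {L N : ℕ} [NeZero N] (hL : 1 ≤ L) (k : ℕ)
    {U W : Site d → Fin d → (Matrix n n ℂ)ˣ} {x : ℝ} (hUu : IsUnitaryCfg U) (hWu : IsUnitaryCfg W)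
    (hUP : IsPeriodicCfg U ((tower L N (k + 1) : ℕ) : ℤ)) (hWP : IsPeriodicCfg W ((tower L N (k + 1) : ℕ) : ℤ))
    (hx : 0 ≤ x) (hs : LevelSmall d L k x) (hUx : SmallField U x) (hWx : SmallField W x)
    {ω : ℝ} (hω : 0 ≤ ω)
    (hTop : ∀ (z : Site d) (κ : Fin d), ‖((cavgIter L (k + 1) U z κ : (Matrix n n ℂ)ˣ) : (Matrix n n ℂ)) - ((cavgIter L (k + 1) W z κ : (Matrix n n ℂ)ˣ) : (Matrix n n ℂ))‖ ≤ ω)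
    {CF : ℝ}
    (hF : ∀ Y : Site d → Fin d → (Matrix n n ℂ), IsSkewDir Y → IsPeriodicDir Y ((tower L N (k + 1) : ℕ) : ℤ) → dirIter L (k + 1) W Y = 0 →
      ∑ z ∈ periodBox (d := d) N, ‖framePotW L (k + 1) W Y z‖ ≤ CF * dirL1 Y (periodBox (d := d) (tower L N (k + 1))))
    (R : (Site d → Fin d → (Matrix n n ℂ)) → Site d → Fin d → (Matrix n n ℂ))
    (hRskew : ∀ φ : Site d → Fin d → (Matrix n n ℂ), IsSkewDir φ → IsPeriodicDir φ (N : ℤ) → IsSkewDir (R φ))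
    (hRper : ∀ φ : Site d → Fin d → (Matrix n n ℂ), IsSkewDir φ → IsPeriodicDir φ (N : ℤ) →
      IsPeriodicDir (R φ) ((tower L N (k + 1) : ℕ) : ℤ))
    (hRexact : ∀ φ : Site d → Fin d → (Matrix n n ℂ), IsSkewDir φ → IsPeriodicDir φ (N : ℤ) → dirIter L (k + 1) U (R φ) = φ)
    {cR : ℝ} (hcR : 0 ≤ cR)
    (hRbd : ∀ φ : Site d → Fin d → (Matrix n n ℂ), IsSkewDir φ → IsPeriodicDir φ (N : ℤ) →
      |dAction U (R φ) (perWin d (tower L N (k + 1)))| ≤ cR * dirL1 φ (periodBox (d := d) N))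
    {Λ : ℝ}
    (hΛ : ∀ Y : Site d → Fin d → (Matrix n n ℂ), IsSkewDir Y → IsPeriodicDir Y ((tower L N (k + 1) : ℕ) : ℤ) → dirIter L (k + 1) W Y = 0 →
      ∑ z ∈ periodBox N, ∑ κ : Fin d, ‖QbarIter L (k + 1) U Y z κ - QbarIter L (k + 1) W Y z κ‖
        ≤ Λ * dirL1 Y (periodBox (d := d) (tower L N (k + 1)))) :
    ∀ Y : Site d → Fin d → (Matrix n n ℂ), IsSkewDir Y → IsPeriodicDir Y ((tower L N (k + 1) : ℕ) : ℤ) →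
      dirIter L (k + 1) W Y = 0 →
      ∃ Y' : Site d → Fin d → (Matrix n n ℂ), IsSkewDir Y' ∧ IsPeriodicDir Y' ((tower L N (k + 1) : ℕ) : ℤ) ∧ dirIter L (k + 1) U Y' = 0 ∧
        |dAction U (fun y μ => Y' y μ - Y y μ) (perWin d (tower L N (k + 1)))|
          ≤ cR * (Λ + 2 * d * ω * CF) * dirL1 Y (periodBox (d := d) (tower L N (k + 1))) := by
  intro Y hY hYP hYT
  have hm : ((L : ℤ) ^ (k + 1)) ≠ 0 := pow_ne_zero _ (by exact_mod_cast (show L ≠ 0 by omega))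
  have htow : ((tower L N (k + 1) : ℕ) : ℤ) = (L : ℤ) ^ (k + 1) * (N : ℤ) := (pow_succ_mul_eq_tower L N k).symm
  -- the generator (as in §2) and its letters
  set g : Site d → (Matrix n n ℂ) := fun w => framePotW L (k + 1) W Y w - framePotW L (k + 1) U Y w with hg
  set lam : Site d → (Matrix n n ℂ) := fun xx => g (fun i => xx i / ((L : ℤ) ^ (k + 1))) with hlam
  obtain ⟨hFUs, hFUP⟩ := framePotW_skew_periodic (M := N) hL k hUu hUP hx hs hUx hY hYP
  obtain ⟨hFWs, hFWP⟩ := framePotW_skew_periodic (M := N) hL k hWu hWP hx hs hWx hY hYP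
  have hgs : ∀ w, g w ∈ skewAdjoint (Matrix n n ℂ) := fun w => (skewAdjoint (Matrix n n ℂ)).sub_mem (hFWs w) (hFUs w)
  have hgP : ∀ (w : Site d) (i : Fin d), g (w + (N : ℤ) • e i) = g w := fun w i => by simp only [hg, hFWP w i, hFUP w i]
  have hlams : ∀ xx, lam xx ∈ skewAdjoint (Matrix n n ℂ) := fun xx => hgs _
  have hlamP : ∀ (y : Site d) (i : Fin d), lam (y + ((tower L N (k + 1) : ℕ) : ℤ) • e i) = lam y := fun y i => by
    rw [htow]; exact cornerLift_add_period g hm hgP y i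
  -- the gauge-corrected direction and its average
  set G : Site d → Fin d → (Matrix n n ℂ) := gaugeDir U lam with hG
  have hGs : IsSkewDir G := gaugeDir_skew hUu hlams
  have hGP : IsPeriodicDir G ((tower L N (k + 1) : ℕ) : ℤ) := isPeriodicDir_gaugeDir hUP hlamP
  set Y₁ : Site d → Fin d → (Matrix n n ℂ) := fun y μ => Y y μ + G y μ with hY₁
  have hY₁s : IsSkewDir Y₁ := fun y μ => (skewAdjoint (Matrix n n ℂ)).add_mem (hY y μ) (hGs y μ)
  have hY₁P : IsPeriodicDir Y₁ ((tower L N (k + 1) : ℕ) : ℤ) := fun y i μ => by simp only [hY₁, hYP y i μ, hGP y i μ]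
  set ψ : Site d → Fin d → (Matrix n n ℂ) := dirIter L (k + 1) U Y₁ with hψ
  obtain ⟨hψs, hψP⟩ := dirIter_skew_periodic (M := N) hL k hUu hUP hx hs hUx hY₁s hY₁P
  -- both tops are unitary, so the defect of §2 is `2ω`-small against the reference frame potential
  have hTopU : IsUnitaryCfg (cavgIter L (k + 1) U) := (cavgIter_unitary_small hL k hUu hx hs hUx).1
  have hTopW : IsUnitaryCfg (cavgIter L (k + 1) W) := (cavgIter_unitary_small hL k hWu hx hs hWx).1
  have hψeq : ∀ (z : Site d) (κ : Fin d), ψ z κ = QbarIter L (k + 1) U Y z κ - QbarIter L (k + 1) W Y z κ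
      + (Ad (cavgIter L (k + 1) U z κ)⁻¹ (framePotW L (k + 1) W Y z) - Ad (cavgIter L (k + 1) W z κ)⁻¹ (framePotW L (k + 1) W Y z)) :=
    fun z κ => dirIter_add_gaugeDir_eq_Qbar_sub_Qbar_add_defect hL k hUu hWu hUP hWP hx hs hUx hWx hY hYP hYT z κ
  have hdef : ∀ (z : Site d) (κ : Fin d),
      ‖Ad (cavgIter L (k + 1) U z κ)⁻¹ (framePotW L (k + 1) W Y z) - Ad (cavgIter L (k + 1) W z κ)⁻¹ (framePotW L (k + 1) W Y z)‖
        ≤ 2 * ω * ‖framePotW L (k + 1) W Y z‖ := by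
    intro z κ
    refine (norm_Ad_inv_sub_Ad_inv_le (hTopU z κ) (hTopW z κ) _).trans ?_
    have h0 : 0 ≤ ‖framePotW L (k + 1) W Y z‖ := norm_nonneg _
    nlinarith [hTop z κ, norm_nonneg (((cavgIter L (k + 1) U z κ : (Matrix n n ℂ)ˣ) : (Matrix n n ℂ)) - ((cavgIter L (k + 1) W z κ : (Matrix n n ℂ)ˣ) : (Matrix n n ℂ)))]
  -- the transported direction
  refine ⟨fun y μ => Y₁ y μ - R ψ y μ, ?_, ?_, ?_, ?_⟩
  · exact fun y μ => (skewAdjoint (Matrix n n ℂ)).sub_mem (hY₁s y μ) (hRskew ψ hψs hψP y μ)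
  · intro y i μ
    simp only [hY₁P y i μ, hRper ψ hψs hψP y i μ]
  · rw [dirIter_sub hL k hUu hx hs hUx Y₁ (R ψ), hRexact ψ hψs hψP]
    funext z κ
    simp [hψ]
  · -- dAction U (Y' − Y) = dAction U G − dAction U (R ψ) = −dAction U (R ψ)
    have e1 : (fun y μ => (fun y μ => Y₁ y μ - R ψ y μ) y μ - Y y μ) = fun y μ => G y μ - R ψ y μ := by
      funext y μ; simp only [hY₁]; abel
    rw [e1, dAction_sub', hG, dAction_gaugeDir, zero_sub, abs_neg]
    refine (hRbd ψ hψs hψP).trans ?_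
    -- the `ℓ¹` size of `ψ = Q̄_U Y − Q̄_W Y + defect` on the coarse period box
    have hmain := hΛ Y hY hYP hYT
    have hfr := hF Y hY hYP hYT
    have h2 : 0 ≤ 2 * (d : ℝ) * ω := by positivity
    have hpt : ∀ z ∈ periodBox (d := d) N, ∑ κ : Fin d, ‖ψ z κ‖
        ≤ (∑ κ : Fin d, ‖QbarIter L (k + 1) U Y z κ - QbarIter L (k + 1) W Y z κ‖)
          + 2 * d * ω * ‖framePotW L (k + 1) W Y z‖ := by
      intro z _
      have hκ : ∀ κ : Fin d, ‖ψ z κ‖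
          ≤ ‖QbarIter L (k + 1) U Y z κ - QbarIter L (k + 1) W Y z κ‖ + 2 * ω * ‖framePotW L (k + 1) W Y z‖ := by
        intro κ
        rw [hψeq z κ]
        exact (norm_add_le _ _).trans (by linarith [hdef z κ])
      calc ∑ κ : Fin d, ‖ψ z κ‖
          ≤ ∑ κ : Fin d, (‖QbarIter L (k + 1) U Y z κ - QbarIter L (k + 1) W Y z κ‖ + 2 * ω * ‖framePotW L (k + 1) W Y z‖) :=
            Finset.sum_le_sum fun κ _ => hκ κ
        _ = (∑ κ : Fin d, ‖QbarIter L (k + 1) U Y z κ - QbarIter L (k + 1) W Y z κ‖) + 2 * d * ω * ‖framePotW L (k + 1) W Y z‖ := by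
            rw [Finset.sum_add_distrib, Finset.sum_const, Finset.card_univ, Fintype.card_fin, nsmul_eq_mul]
            ring
    have hsum : dirL1 ψ (periodBox (d := d) N)
        ≤ (∑ z ∈ periodBox N, ∑ κ : Fin d, ‖QbarIter L (k + 1) U Y z κ - QbarIter L (k + 1) W Y z κ‖)
          + 2 * d * ω * ∑ z ∈ periodBox (d := d) N, ‖framePotW L (k + 1) W Y z‖ := by
      have h := Finset.sum_le_sum hpt
      rw [Finset.sum_add_distrib, ← Finset.mul_sum] at h
      exact h
    have hψ1 : dirL1 ψ (periodBox (d := d) N) ≤ (Λ + 2 * d * ω * CF) * dirL1 Y (periodBox (d := d) (tower L N (k + 1))) :=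
      calc dirL1 ψ (periodBox (d := d) N)
          ≤ (∑ z ∈ periodBox N, ∑ κ : Fin d, ‖QbarIter L (k + 1) U Y z κ - QbarIter L (k + 1) W Y z κ‖)
              + 2 * d * ω * ∑ z ∈ periodBox (d := d) N, ‖framePotW L (k + 1) W Y z‖ := hsum
        _ ≤ Λ * dirL1 Y (periodBox (d := d) (tower L N (k + 1)))
              + 2 * d * ω * (CF * dirL1 Y (periodBox (d := d) (tower L N (k + 1)))) :=
            add_le_add hmain (mul_le_mul_of_nonneg_left hfr h2)
        _ = (Λ + 2 * d * ω * CF) * dirL1 Y (periodBox (d := d) (tower L N (k + 1))) := by ring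
    calc cR * dirL1 ψ (periodBox (d := d) N) ≤ cR * ((Λ + 2 * d * ω * CF) * dirL1 Y (periodBox (d := d) (tower L N (k + 1)))) :=
          mul_le_mul_of_nonneg_left hψ1 hcR
      _ = cR * (Λ + 2 * d * ω * CF) * dirL1 Y (periodBox (d := d) (tower L N (k + 1))) := by ring

end

end Summit.QuantumFields.BalabanUV.T4Continuum.NE7TangentTransportCurved
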